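import Literature.MathematicalPhysics.QuantumFieldTheory.Balaban1983to89.B9Eq326DRDsKernelDecayZd
import Literature.MathematicalPhysics.QuantumFieldTheory.Balaban1983to89.B8CubeMemberLevelDisjoint

/-!
# `Balaban1983to89.B9Eq326KernelDecayCubeMemberZd` — [Balaban1985BackgroundPropagators] Thm 3.1 p. 397, Thm 3.2 p. 398, (3.25) p. 394, (3.26) p. 395, Thm 3.11 p. 416
# AT THE CUBE MEMBERS `{□_j}` OF [Balaban1985RegularSpaces] (1.131): STATIONS 2, 3 AND 4a OF THE COMBES–THOMAS ROAD WITH NO DISPLAYED HYPOTHESIS —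
# the kernels of `(Q′G′(U₀)²Q′*)⁻¹`, of `R(U₀) = I − G′Q′*(Q′G′²Q′*)⁻¹Q′G′`, and of the `D R(U₀) 𝟙_{□₀} D*` letter of `Δ_a(U₀)` decay exponentially, with one pair of
# constants over the closed small-field class `‖U₀(∂p) − 1‖ ≤ β` (`β < (α_Q∕L²)L^{−2m}`), for EVERY unitary `U₀` of the class — print's «Q′ onto» (`Q′*` injective)
# being a THEOREM at the canonical finsets of the cube member (dag-n05∕n06's `B8CubeMemberLevelDisjoint.qprimeStarInjective_cubeLamS`)

statement-level skeleton of published theorems with citation tags; proofs where landed; nothing here is a claim about the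
Yang–Mills mass gap

`[Balaban1985BackgroundPropagators]` ("B9", CMP **99** (1985) 389–434) Thm 3.1 ∕ (3.42) p. 397, Thm 3.2 p. 398, (3.25) p. 394, (3.26) p. 395, (3.63)–(3.68) pp. 404–405,
Thm 3.11 p. 416; `[Balaban1985RegularSpaces]` ("B8") (1.131) p. 99 (the cube members), Prop. 6 p. 99, (1.7) p. 77.  HERE: three corollaries — this seat's
`B9Eq325QGGQDecayPlaqClosedZd.exists_fnorm_cZd_single_le_exp_plaqClosed_uniform`, `B9Eq325RKernelDecayZd.exists_fnorm_Rop_single_le_exp_plaqClosed`,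
`B9Eq326DRDsKernelDecayZd.exists_fnorm_DRD_bump_le_exp_plaqClosed` at `Ω₀ := □₀`, `Λ_j := cubeLamS … m j` (finsets by `cubeFam_zero_finite`, `cubeLamS_finite`),
with `hinj` supplied by `qprimeStarInjective_cubeLamS` (every background of units, `m ≤ k`, `L ≤ ρ`).

CITATION HEADER (lean-in-tree rule).  Cell `pub-ymgap` (YM Track A, HUMAN RULING D-0062 ∕ D-0149 width push), DAG node N06 = [B9], width seat
`pub-ymgap-dag-n06-w2` (g4), CLAIM-13.  Inputs BY NAME as listed.  Nothing restated; constants crude and member-dependent, NOT print's.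

WHAT IS PROVED (kernel, 0 sorry, 0 def).
* ★★★ `exists_fnorm_cZd_single_le_exp_cubeMember` — station 2 at the cube member, no displayed hypothesis.
* ★★★ `exists_fnorm_Rop_single_le_exp_cubeMember` — station 3 at the cube member, no displayed hypothesis.
* ★★★ `exists_fnorm_DRD_bump_le_exp_cubeMember` — station 4a (the `DRD*` letter on Hermitian single-bond bumps) at the cube member, no displayed hypothesis.

HONEST SCOPE.  Count-neutral helper; per-member (through `η`, `m`, `L`, `β` and the cube data), NOT member-uniform; no estimate of [B9] with print's constants;
N05 ∕ N06 NOT discharged; K1⁹ `stmt-QuantumFields-27364` NOT closed; one finite `𝕋⁴` programme at fixed `ε`, Bałaban as printed; R4 closes only the conditional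
finite-`𝕋⁴` rung `BalabanLadder.UV` — nothing continuum ∕ ℝ⁴ ∕ OS ∕ mass gap ∕ Clay.  Unit `pub-ymgap-dag-n06-w2` (g4), 2026-08-28.
-/

noncomputable section

open scoped BigOperators

namespace Literature.MathematicalPhysics.QuantumFieldTheory.Balaban1983to89.B9Eq326KernelDecayCubeMemberZd

open B7Eq78Linearization (conjR)
open B7Prop2Explicit (unitaryUnits)
open B7Prop5Flat (bump)
open B8Ineq132 (covDerivFwd plaqF)
open B8Eq138LandauZd (covDivB)
open B8Eq131CubesAdmissible (cubeFam)
open B8CubeMemberZd (cubeLamS)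
open B8Eq191FlatLettersCubeMember (cubeLamS_finite cubeFam_zero_finite)
open B8CubeMemberLevelDisjoint (qprimeStarInjective_cubeLamS)
open B9Eq321LandauProjectionZd (suppSub projR)
open B9Eq324DeltaPrimeAZd (single restrictSite)
open B9Eq325QGGQInvZd (cZd)
open B9Eq325ProjFormulaZd (Rop)
open B9Eq316AveragingTransposeZd (alphaQ)
open B9Eq342CombesThomasFormZd (fnorm)
open B9Eq325QGGQDecayOfCoerciveZd (levIndex singleL)
open B9Eq325QGGQDecayPlaqClosedZd (exists_fnorm_cZd_single_le_exp_plaqClosed_uniform)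
open B9Eq325RKernelDecayZd (exists_fnorm_Rop_single_le_exp_plaqClosed)
open B9Eq326DRDsKernelDecayZd (exists_fnorm_DRD_bump_le_exp_plaqClosed)
open LatticeNorms (linfDist)

export B7Prop1Explicit (Site)

variable {d : ℕ} {𝔸 : Type*} [CStarAlgebra 𝔸] [FiniteDimensional ℝ 𝔸] [Nontrivial 𝔸]
variable (L : ℕ) (η : ℝ) (τ : 𝔸 →ₗ[ℂ] ℂ) (hτp : ∀ a : 𝔸, a ≠ 0 → 0 < (τ (star a * a)).re)
  (hτt : ∀ a b : 𝔸, τ (a * b) = τ (b * a)) (hτs : ∀ a : 𝔸, τ (star a) = starRingEnd ℂ (τ a))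
  (m : ℕ) (a : ℕ → ℝ) (a₀ : Site d) (M ρ k : ℕ)

include hτt hτs in
/-- ★★★ **STATION 2 AT THE CUBE MEMBER, NO DISPLAYED HYPOTHESIS**: `0 < d`, `2 ≤ L ≤ ρ`, `m ≤ k`, `η ≠ 0`, `a ≥ 0`, `β < (α_Q∕L²)L^{−2m}`; `Ω₀ := □₀`, `Λ_j := cubeLamS … m j`.
Then `∃ C″ > 0, κ″ > 0` with `|((Q′G′(U₀)²Q′*)⁻¹ δ_{(j′,y′)}w)(j,y)|_τ ≤ C″·e^{−κ″|Lʲy − L^{j′}y′|_∞}·|w|_τ` for EVERY unitary `U₀` with `‖U₀(∂p) − 1‖ ≤ β` and all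
constraint points — `Q′*` injective by `qprimeStarInjective_cubeLamS`.
[cite: Balaban1985BackgroundPropagators, (3.25) p.394, Thm 3.2 p.398, Thm 3.11 p.416; Balaban1985RegularSpaces, (1.131) p.99, Prop. 6 p.99, (1.7) p.77] -/
theorem exists_fnorm_cZd_single_le_exp_cubeMember (hd : 0 < d) (hL : 2 ≤ L) (hρ : L ≤ ρ) (hm : m ≤ k) (hη : η ≠ 0) (ha : ∀ j, 0 ≤ a j) {β : ℝ}
    (hβ : β < alphaQ d L / (L : ℝ) ^ 2 * (((L : ℝ) ^ m)⁻¹) ^ 2) :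
    haveI : NeZero L := ⟨by omega⟩
    ∃ C'' : ℝ, 0 < C'' ∧ ∃ κ'' : ℝ, 0 < κ'' ∧ ∀ (U₀ : Site d → Fin d → 𝔸ˣ) (hU : ∀ x κ', U₀ x κ' ∈ unitaryUnits 𝔸),
      (∀ (x : Site d) (μ ν : Fin d), ‖plaqF U₀ μ ν x - 1‖ ≤ β) →
        ∀ p ∈ levIndex m (fun j => (cubeLamS_finite L a₀ M ρ k m j).toFinset), ∀ p' ∈ levIndex m (fun j => (cubeLamS_finite L a₀ M ρ k m j).toFinset), ∀ w : 𝔸,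
          fnorm τ ((cZd L U₀ η τ hτp m a (fun j => (cubeLamS_finite L a₀ M ρ k m j).toFinset) (cubeFam_zero_finite L a₀ M ρ k).toFinset hd hη hτt hτs hU ha
              (qprimeStarInjective_cubeLamS a₀ M hρ hm U₀ τ hτp hτs) (singleL m _ p' w) : ℕ × Site d → 𝔸) p) ≤
            C'' * Real.exp (-(κ'' * (linfDist (fun i => ((L : ℤ) ^ p.1) * p.2 i) (fun i => ((L : ℤ) ^ p'.1) * p'.2 i) : ℝ))) * fnorm τ w := by
  haveI : NeZero L := ⟨by omega⟩
  exact exists_fnorm_cZd_single_le_exp_plaqClosed_uniform L η τ hτp hτt hτs m a _ _ hd hL hη ha hβ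
    (fun U₀ _ => qprimeStarInjective_cubeLamS a₀ M hρ hm U₀ τ hτp hτs)

include hτt hτs in
/-- ★★★ **STATION 3 AT THE CUBE MEMBER, NO DISPLAYED HYPOTHESIS**: same data; `∃ C_R > 0, κ_R > 0` with `|(R(U₀)δ_y w)(x)|_τ ≤ C_R·e^{−κ_R|x−y|_∞}·|w|_τ` for EVERY
unitary `U₀` of the closed class, every `y ∈ □₀`, `w`, `x`, `R(U₀) = I − G′Q′*(Q′G′²Q′*)⁻¹Q′G′`.
[cite: Balaban1985BackgroundPropagators, (3.25) p.394, (3.63)–(3.68) pp.404–405, Thm 3.11 p.416; Balaban1985RegularSpaces, (1.131) p.99, Prop. 6 p.99, (1.7) p.77] -/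
theorem exists_fnorm_Rop_single_le_exp_cubeMember (hd : 0 < d) (hL : 2 ≤ L) (hρ : L ≤ ρ) (hm : m ≤ k) (hη : η ≠ 0) (ha : ∀ j, 0 ≤ a j) {β : ℝ}
    (hβ : β < alphaQ d L / (L : ℝ) ^ 2 * (((L : ℝ) ^ m)⁻¹) ^ 2) :
    haveI : NeZero L := ⟨by omega⟩
    ∃ CR : ℝ, 0 < CR ∧ ∃ κR : ℝ, 0 < κR ∧ ∀ (U₀ : Site d → Fin d → 𝔸ˣ) (hU : ∀ x κ', U₀ x κ' ∈ unitaryUnits 𝔸),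
      (∀ (x : Site d) (μ ν : Fin d), ‖plaqF U₀ μ ν x - 1‖ ≤ β) →
        ∀ y ∈ (cubeFam_zero_finite L a₀ M ρ k).toFinset, ∀ (w : 𝔸) (x : Site d),
          fnorm τ ((Rop L U₀ η τ hτp m a (fun j => (cubeLamS_finite L a₀ M ρ k m j).toFinset) (cubeFam_zero_finite L a₀ M ρ k).toFinset hd hη hτt hτs hU ha
              (qprimeStarInjective_cubeLamS a₀ M hρ hm U₀ τ hτp hτs) (restrictSite _ (single y w)) : Site d → 𝔸) x) ≤
            CR * Real.exp (-(κR * (linfDist x y : ℝ))) * fnorm τ w := by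
  haveI : NeZero L := ⟨by omega⟩
  exact exists_fnorm_Rop_single_le_exp_plaqClosed L η τ hτp hτt hτs m a _ _ hd hL hη ha hβ
    (fun U₀ _ => qprimeStarInjective_cubeLamS a₀ M hρ hm U₀ τ hτp hτs)

include hτp hτt hτs a in
/-- ★★★ **STATION 4a AT THE CUBE MEMBER, NO DISPLAYED HYPOTHESIS**: same data; `∃ C_D > 0, κ_D > 0` with
`|(D^η_{U₀,μ} R(U₀) 𝟙_{□₀} D^{η*}_{U₀} δ_{(y′,ν)}w)(x)|_τ ≤ C_D·e^{−κ_D|x−y′|_∞}·|w|_τ` for EVERY unitary `U₀` of the closed class, every bond `(y′,ν)`, direction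
`μ`, site `x`, Hermitian `w` — the `DRD*` letter of `Δ_a(U₀)` (3.26) at `□₀` with the level sets `cubeLamS … m ·`.
[cite: Balaban1985BackgroundPropagators, (3.26) p.395, (3.25) p.394, (3.63)–(3.68) pp.404–405, Thm 3.11 p.416; Balaban1985RegularSpaces, (1.131) p.99, (1.1) p.76, (1.7) p.77] -/
theorem exists_fnorm_DRD_bump_le_exp_cubeMember (hd : 0 < d) (hL : 2 ≤ L) (hρ : L ≤ ρ) (hm : m ≤ k) (hη : η ≠ 0) (ha : ∀ j, 0 ≤ a j) {β : ℝ}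
    (hβ : β < alphaQ d L / (L : ℝ) ^ 2 * (((L : ℝ) ^ m)⁻¹) ^ 2) :
    ∃ CD : ℝ, 0 < CD ∧ ∃ κD : ℝ, 0 < κD ∧ ∀ (U₀ : Site d → Fin d → 𝔸ˣ), (∀ x κ', U₀ x κ' ∈ unitaryUnits 𝔸) →
      (∀ (x : Site d) (μ ν : Fin d), ‖plaqF U₀ μ ν x - 1‖ ≤ β) →
        ∀ (y' : Site d) (ν μ : Fin d) (x : Site d) (w : 𝔸), IsSelfAdjoint w →
          fnorm τ (covDerivFwd η U₀ μ (projR τ (cubeFam_zero_finite L a₀ M ρ k).toFinset L m η (fun j => cubeLamS L a₀ M ρ k m j) U₀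
            (covDivB η U₀ (bump y' ν w))) x) ≤ CD * Real.exp (-(κD * (linfDist x y' : ℝ))) * fnorm τ w := by
  haveI : NeZero L := ⟨by omega⟩
  have hcoe : (fun j => (↑((cubeLamS_finite L a₀ M ρ k m j).toFinset) : Set (Site d))) = fun j => cubeLamS L a₀ M ρ k m j :=
    funext fun j => Set.Finite.coe_toFinset _
  obtain ⟨CD, hCD, κD, hκD, h⟩ := exists_fnorm_DRD_bump_le_exp_plaqClosed L η τ hτp hτt hτs m a
    (fun j => (cubeLamS_finite L a₀ M ρ k m j).toFinset) (cubeFam_zero_finite L a₀ M ρ k).toFinset hd hL hη ha hβ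
    (fun U₀ _ => qprimeStarInjective_cubeLamS a₀ M hρ hm U₀ τ hτp hτs)
  refine ⟨CD, hCD, κD, hκD, fun U₀ hU hplaq y' ν μ x w hw => ?_⟩
  rw [← hcoe]
  exact h U₀ hU hplaq y' ν μ x w hw

end Literature.MathematicalPhysics.QuantumFieldTheory.Balaban1983to89.B9Eq326KernelDecayCubeMemberZd

end
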